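import Summits.BirchSwinnertonDyer.BirchSwinnertonDyer.Theorems.SemiOrdinaryEisensteinDescentWildSplitEisensteinValueAtOneVStepLNormalForm
import Summits.BirchSwinnertonDyer.BirchSwinnertonDyer.Theorems.UniversalToricDescentWildSplitControlAtThreeOfPoitouTate
import Summits.BirchSwinnertonDyer.BirchSwinnertonDyer.Theorems.AdditiveRankOneBSDpOfExactIndexManin
import Literature.NumberTheory.EllipticCurves.Rank1Residual.Typed.JointLower
import HarnessLib

/-!
# Route `SemiOrdinaryEisensteinDescent`, crux #2″ `WildSplitEisensteinValueAtOneV` (`E_𝟙^V`, stmt-BirchSwinnertonDyer-26610):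
# the ℚ-LEVEL NORMAL FORM — modulo print and the rank-zero leaf, crux #2″ IS the `r = 1` LOWER HALF of `BSD₃` on the onto
# wild cell, curve by curve, in Miller's currency `MissingLowerBoundAt W 3`; the rung is «crux #2″ ∧ the UPPER half»
# (cell `pub/bsd-wall`, width seat `bsd-wall-soed-p1-w3` g14, `--supports stmt-BirchSwinnertonDyer-26610`, helper)

WHY. The record so far expresses crux #2″ in three currencies, all over an imaginary quadratic Heegner field `K`:
the Λ-adic/value-at-𝟙 display `E_𝟙^V` (the item text), the Heegner-index socket `L₃ʷ°`
(`SchneiderFree.IndexLowerBoundLeAt W 3 K P (v₃ c)` on the odd Friedberg–Hoffstein data; w3 g13's normal form p615634: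
`E_𝟙^V ⟺ L₃ʷ°` modulo {Kolyvagin, W 24476, PT1, C}, C dischargeable by PT1 + PT2), and the joint lower half of `BSD₃` over the
pair `(E, E^{(d_K)})` (door-c5's item 19180 `SchneiderFree.Exact.jointLowerBoundAt_of_stepL_manin` and its converse
`WildKolyvaginUpperAtThreeTight.indexLowerBoundLeAt_of_jointLowerBoundAt`). Since the rank-zero leaf Z (item 20387,
`WAllExclAddWildRankZero` by name) is a binder of `closes` ANYWAY and pays the full `BSD₃` of the twist `E^{(d_K)}`, the field
`K` can be eliminated altogether. This file does that, kernel-checked, in the tree's per-curve Miller currency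
(`Literature.NumberTheory.EllipticCurves.Rank1Residual.Typed.MissingLowerBoundAt W 3`:
«`#Ш(E/ℚ)_an` is a rational `q` with `ord₃ q ≤ ord₃ #Ш(E/ℚ)`», the «IMC / Eisenstein» half of `BSD(E,3)`):

* §1 `missingLowerBoundAt_of_stepL` — **PUB → Z → `L₃ʷ°` → [∀ cell `W` with `r_an = 1`, `MissingLowerBoundAt W 3`]**:
  parity ⟹ `w(E) = −1`; Friedberg–Hoffstein (auxiliary modulus `2`) ⟹ an odd Heegner field with `L(E^{(d_K)},1) ≠ 0`;
  Heegner point, non-torsion by Gross–Zagier; `L₃ʷ°` at that datum ⟹ the joint lower half over `(E, E^{(d_K)})`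
  (item 19180 ✓); Z ⟹ `BSD₃` of a minimal model of the twist ⟹ its upper half; subtract.
* §2 `stepL_of_lowerHalf` — **PUB → Z → [lower half on the cell] → `L₃ʷ°`** at EVERY odd Friedberg–Hoffstein datum:
  the lower half of `E` + the lower half of the twist (from Z) ⟹ the joint lower half ⟹ the socket (KoTight §4).
* §3 `stepL_iff_lowerHalf` — **modulo {PUB 20389, Z 20387}: `L₃ʷ°` ⟺ [∀ cell `W`, `MissingLowerBoundAt W 3`].**
* §4 `valueAtOneV_iff_lowerHalf` — **modulo {PUB, W 24476, PT1 20461, PT2 (UTD 20462), Z}: `E_𝟙^V` (BY NAME) ⟺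
  [∀ cell `W`, `MissingLowerBoundAt W 3`]** — the crux of record is, statement for statement, the `r = 1` lower half of
  `BSD₃` on the onto wild cell; the Heegner field, the index, the anticyclotomic frame, the BDP `L`-function and the unit
  display are packaging that the print binders translate away. (Necessity «leaf ⟹ `E_𝟙^V`» is the special case
  `BSD₃(E) ⟹ lower half`.)
* §5 `wAllExclAddWildRankOneSurj_iff_lowerHalf_and_upperHalf` — **modulo GZK alone: the rung `WAllExclAddWildRankOneSurj` ⟺
  [lower half on the cell] ∧ [upper half on the cell]** (`MissingUpperBoundAt W 3`, the «Euler-system» half; Miller's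
  Def. 1.1 split in two, `Ш` finite by Gross–Zagier–Kolyvagin).
* §6 `wAllExclAddWildRankOneSurj_iff_valueAtOneV_and_upperHalf` — **modulo {PUB, W, PT1, PT2, Z}: rung ⟺ `E_𝟙^V` ∧
  [upper half on the cell].** So the route's `closes` is, at the level of statements, the decomposition
  «`BSD₃` = lower half + upper half» on the cell: crux #2″ carries EXACTLY the lower half, and the Kolyvagin column
  (Prims 25896 + Jetchev max-form 25897 + `J‴` 25898, through Ko′) is consumed exactly as a supplier of the upper half
  (soed-p2-w3 g0's `…WildKolyvaginUpperAtThreeOfJointUpper`: Ko ⟺ joint upper half, per frame). Companion reading on the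
  UTD side: utd-p3 g6's `UniversalToricDescentLowerHalf.missingLowerBoundAt_three_of_transport_of_poitouTate_of_wildRankZeroTwist`
  (UTD cruxes #2–#4 + PT1 + Z ⟹ the same lower half on the twin rung).

READING FOR THE PEN / THE VET OF 26610 (numbers, not adjectives): (i) crux #2″ cannot be weakened inside this `closes`:
any statement X with «PUB + W + PT + Z + Kolyvagin column + X ⟹ rung» implies the lower half on the cell (§5–§6), i.e.
implies `E_𝟙^V` (§4); (ii) conversely nothing Eisenstein-specific survives in the item: a line for 26610 is a line for
«`ord₃ #Ш(E)_an ≤ ord₃ #Ш(E)` for every non-CM `E/ℚ` with `ClassO6` at `3`, `ρ̄_{E,3}` onto, `r_an = 1`», and may use ANY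
engine (Eisenstein congruences, Kolyvagin-system indivisibility `M_∞ ≤ ord₃(c·∏c_ℓ)`, Kato-side structure theorems at `3`,
visibility) — the route's U(3,1) thesis lives only in its dead lines, not in its open statement; (iii) the trust-base
cost of stating the lower half as `E_𝟙^V` rather than in Miller's currency is exactly {W 24476, PT1, PT2} (§4 vs §3).

HONEST FRAMING: bookkeeping, CONDITIONAL on every displayed antecedent; the lower half on the cell (= `E_𝟙^V` = `L₃ʷ°`
modulo print + Z), the upper half beyond Jetchev's single-carrier max-form (`J‴`) and Z are research-open — no engine for
the lower half at an additive potentially supersingular `3` is in print (walls W1–W3 of `Cruxes/WildSplitEisensteinInclusionAtThree/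
Lines/birth-dead*.md`; presearch 2026-08-28: arXiv:2603.22483, 2306.17784, 2603.12357, 2601.14504, 2505.09121, 2310.06813,
2312.09301 all need `p ≥ 5` or good reduction for the Heegner/anticyclotomic side; Kim 2505.09121 §3 + Sakamoto 2024 treat
the KATO side at `p = 3` modulo the cyclotomic main conjecture localised at the augmentation ideal, open at a supercuspidal `3`).
No crux is claimed false; nothing is asserted about any curve; closes nothing; BSD₃ is proved for no curve by this file.
No definition, no named fact, no `sorry`.

References: [Miller2011LMS] Def. 1.1 (arXiv:1010.2431 p. 3); [JetchevSkinnerWan2017] Thm. 3.3.1, §7.4.1 (arXiv:1512.06894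
pp. 11, 30); [GrossZagier1986] I.(6.3), (7.3), V §2; [FriedbergHoffstein1995] Thm. B; [Kolyvagin1990] Thm. A; [MilneADT2006]
I Thm. 4.10; [Castella2018] Thm. 2.3, §5; [Zywina2015] Prop. 1.14, 1.16.
-/

noncomputable section

open scoped Classical NumberField

set_option linter.dupNamespace false -- `Summit.BirchSwinnertonDyer.BirchSwinnertonDyer.Theorems.…` (summit = sub, D-0017)
set_option autoImplicit false

namespace Summit.BirchSwinnertonDyer.BirchSwinnertonDyer.Theorems.WildSplitEisensteinValueAtOneVLowerHalf

open WeierstrassCurve NumberField IsDedekindDomain Field PowerSeries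
  Literature.NumberTheory.EllipticCurves
  Literature.NumberTheory.EllipticCurves.ModularForms
  Literature.NumberTheory.EllipticCurves.Rank1Residual
  Literature.NumberTheory.EllipticCurves.Rank1Residual.Typed
  Literature.NumberTheory.EllipticCurves.KrizLi2019
  Literature.NumberTheory.GaloisCohomology
  Summit.BirchSwinnertonDyer.Rank1Residual
  Summit.BirchSwinnertonDyer.Rank1Residual.Additive
  Summit.BirchSwinnertonDyer.Rank1Residual.X11b
  Summit.BirchSwinnertonDyer.Rank1Residual.X11b.AcSelmer
  Summit.BirchSwinnertonDyer.Rank1Residual.X11b.Halves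
  Summit.BirchSwinnertonDyer.BirchSwinnertonDyer.Theses.SemiOrdinaryEisensteinDescent
  Summit.BirchSwinnertonDyer.BirchSwinnertonDyer.Theorems

/-! ### §0 The twist's halves from the rank-zero leaf Z (local bookkeeping, cf. utd-p3 g6 `missingUpperBoundAt_twist_of_wildRankZeroTwist`) -/

/-- **Z pays `BSD₃` of the Heegner twist, hence BOTH of its halves.** For a cell curve `W` (O6 at `3`, `ρ̄₃` onto) and an
odd Heegner field `K` with `L(E^{(d_K)},1) ≠ 0`, a globally minimal model `Wd` of `E^{(d_K)}` is a non-CM O6 row of analytic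
rank `0` (`classO6_twist_of_heegner`, `hasCM_iff_of_j_eq`), so the leaf Z (`WildRankZeroTwistAtThree = WAllExclAddWildRankZero`)
gives `BSD₃(Wd)`, i.e. `MissingLowerBoundAt Wd 3 ∧ MissingUpperBoundAt Wd 3` (`Ш(Wd)` finite by GZK). CONDITIONAL on Z and
GZK. [cite: Zywina2015, Prop. 1.14 and Prop. 1.16] [cite: Miller2011LMS, Def. 1.1 (arXiv:1010.2431 p. 3)] -/
theorem lower_and_upper_twist_of_wildRankZeroTwist (hGZK : rank_eq_analyticRank_of_analyticRank_le_one)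
    (hZ : WildRankZeroTwistAtThree) (W : WeierstrassCurve ℚ) [W.IsElliptic] [W.IsGloballyMinimal]
    (hO6 : ClassO6 W 3) (hsurj : W.HasSurjectiveModNGaloisRep 3) {N : ℕ} (hN : W.conductorNorm ℤ = N)
    (K : Type) [Field K] [NumberField K] (hK : IsImaginaryQuadratic K) (hHN : SatisfiesHeegnerHypothesis N K)
    (hodd : Odd (NumberField.discr K)) (Wd : WeierstrassCurve ℚ) [Wd.IsElliptic] [Wd.IsGloballyMinimal]
    (hWd : ∃ C : VariableChange ℚ, C • W.quadraticTwist (NumberField.discr K : ℚ) = Wd)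
    (hLd : (W.quadraticTwist (NumberField.discr K : ℚ)).entireLFunction 1 ≠ 0) :
    MissingLowerBoundAt Wd 3 ∧ MissingUpperBoundAt Wd 3 := by
  haveI : Fact (Nat.Prime 3) := ⟨Nat.prime_three⟩
  obtain ⟨Cd, hCd⟩ := hWd
  have hHN' : SatisfiesHeegnerHypothesis (W.conductorNorm ℤ) K := by rw [hN]; exact hHN
  obtain ⟨hO6d, hjd⟩ := classO6_twist_of_heegner W hO6 K hK hHN' hodd Wd Cd hCd
  have hCM : ¬ W.HasCM := fun hCM ↦
    W.not_hasSurjectiveModNGaloisRep_of_hasCM hCM Nat.prime_three (by decide) hsurj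
  have hCMd : ¬ Wd.HasCM := fun h ↦ hCM ((hasCM_iff_of_j_eq hjd).mp h)
  have hD0 : (NumberField.discr K : ℚ) ≠ 0 := by exact_mod_cast NumberField.discr_ne_zero K
  haveI : (W.quadraticTwist (NumberField.discr K : ℚ)).IsElliptic := W.isElliptic_quadraticTwist hD0
  have hLd1 : Wd.entireLFunction 1 ≠ 0 := by rw [← hCd, entireLFunction_smul]; exact hLd
  have hrd : Wd.analyticRank = 0 := analyticRank_eq_zero_of_entireLFunction_one_ne_zero Wd hLd1
  have hWdBSD : BSDp Wd 3 := (show Summit.BirchSwinnertonDyer.WAllExclAddWildRankZero from hZ) Wd hCMd hO6d hrd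
  obtain ⟨-, hfinWd⟩ := hGZK Wd (by rw [hrd]; exact Nat.zero_le _)
  haveI : Finite Wd.sha := hfinWd
  exact lower_and_upper_of_missingPPartAt Wd 3 (missingPPartAt_of_bsdp Wd 3 hWdBSD)

/-! ### §1 `L₃ʷ°` ⟹ the lower half on the cell (PUB + Z) -/

/-- **`PublishedInputsWildThree → WildRankZeroTwistAtThree → L₃ʷ° → [∀ cell W with r_an = 1, MissingLowerBoundAt W 3]`.**
Given the STEP-L socket at the Manin slack on every odd Friedberg–Hoffstein datum (displayed hypothesis `hL`): for a
cell curve, parity gives `w(E) = −1`, Friedberg–Hoffstein with auxiliary modulus `2` an odd Heegner field `K` with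
`L(E^{(d_K)},1) ≠ 0`, the modular parametrisation a Heegner point `P` over `K`, non-torsion by Gross–Zagier; `hL` there
and door-c5's `SchneiderFree.Exact.jointLowerBoundAt_of_stepL_manin` (item 19180 ✓, Gross–Zagier I.(6.3)/(7.3)
bookkeeping) give the joint lower half over `(E, E^{(d_K)})`; Z gives the twist's upper half (§0); subtract
(`missingLowerBoundAt_of_joint_of_upper`). CONDITIONAL; nothing asserted about any curve.
[cite: FriedbergHoffstein1995, Thm. B] [cite: GrossZagier1986, Thm. I.(6.3) and (7.3)]
[cite: JetchevSkinnerWan2017, §7.4.1 (arXiv:1512.06894 p. 30)] [cite: Miller2011LMS, Def. 1.1 (arXiv:1010.2431 p. 3)] -/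
theorem missingLowerBoundAt_of_stepL (hF : PublishedInputsWildThree) (hZ : WildRankZeroTwistAtThree)
    (hL : ∀ (W : WeierstrassCurve ℚ) [W.IsElliptic] [W.IsGloballyMinimal] (N : ℕ) [NeZero N] (K : Type) [Field K]
      [NumberField K] (Dt : ModularParametrizationData W N) (H : HeegnerDatum N (NumberField.discr K)) (ι : K →+* ℂ)
      (P : (W.baseChange K).toAffine.Point), ClassO6 W 3 → W.HasSurjectiveModNGaloisRep 3 → W.analyticRank = 1 →
      W.conductorNorm ℤ = N → IsImaginaryQuadratic K → SatisfiesHeegnerHypothesis N K →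
      (W.quadraticTwist (NumberField.discr K : ℚ)).entireLFunction 1 ≠ 0 →
      WeierstrassCurve.Affine.Point.map ι.toRatAlgHom P = heegnerPointComplex Dt H → ¬ IsOfFinAddOrder P →
      Odd (NumberField.discr K) → SchneiderFree.IndexLowerBoundLeAt W 3 K P (padicValNat 3 Dt.c.natAbs)) :
    ∀ (W : WeierstrassCurve ℚ) [W.IsElliptic] [W.IsGloballyMinimal], ClassO6 W 3 → W.HasSurjectiveModNGaloisRep 3 →
      W.analyticRank = 1 → MissingLowerBoundAt W 3 := by
  intro W _ _ hO6 hsurj hr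
  obtain ⟨hGZ, hKo, hGZK, hmod, -, -, hGZ73, hFH, hpar, hHP⟩ := hF
  haveI hN0 : NeZero (W.conductorNorm ℤ) := ⟨W.conductorNorm_pos_holds.ne'⟩
  haveI : Fact (Nat.Prime 3) := ⟨Nat.prime_three⟩
  -- parity: `r_an = 1` is odd, so `w(E) = -1`
  have hw : W.rootNumber = -1 := by
    rcases W.rootNumber_eq_one_or with h | h
    · exfalso
      have heven : Even W.analyticRank := (hpar W).mpr h
      rw [hr] at heven
      exact Nat.not_even_one heven
    · exact h
  -- Friedberg–Hoffstein with auxiliary modulus `2`: Heegner for `N(E)`, `2` split (so `d_K` odd), `L(E^{(d_K)},1) ≠ 0`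
  obtain ⟨K, _, _, hK, -, hHN, hH2, hLt⟩ := hFH W hw 2 two_ne_zero 0
  have hodd : Odd (NumberField.discr K) := by
    have h8 := Literature.SatisfiesHeegnerHypothesis.discr_emod_eight hK.1 hH2 (dvd_refl 2)
    rw [Int.odd_iff]; omega
  -- `3 ∣ N(E)` (additive) splits in `K`: `3 ∤ #𝓞_K^×`
  have h3N : 3 ∣ W.conductorNorm ℤ :=
    (W.dvd_conductorNorm_iff_not_hasGoodReductionAtPrime 3).mpr (not_good_of_addv W 3 hO6.2.1)
  have hw3 : ¬ 3 ∣ Units.torsionOrder K :=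
    (X11b.Three.not_dvd_discr_and_not_dvd_torsionOrder_of_heegner hK hHN (by decide) h3N).2
  -- the Heegner point over `K`, non-torsion by Gross–Zagier
  obtain ⟨P, Dt, H, ι, hP⟩ := hHP W K hK hHN
  have hL0 : W.entireLFunction 1 = 0 := entireLFunction_one_eq_zero_of_analyticRank_eq_one hr
  obtain ⟨-, hderiv⟩ := leadingLCoeff_eq_deriv_of_analyticRank_eq_one hr
  have hLK : LDerivEK W K ≠ 0 := by
    rw [lDerivEK_eq_deriv_mul W K hmod hL0]; exact mul_ne_zero hderiv hLt
  have hnt : ¬ IsOfFinAddOrder P :=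
    (lDerivEK_ne_zero_iff_not_isOfFinAddOrder W (W.conductorNorm ℤ) K (hGZ _ W K) hK hHN
      ⟨Dt, H, ι, hP⟩).mp hLK
  -- the socket at this datum (hypothesis)
  have hlo : SchneiderFree.IndexLowerBoundLeAt W 3 K P (padicValNat 3 Dt.c.natAbs) :=
    hL W (W.conductorNorm ℤ) K Dt H ι P hO6 hsurj hr rfl hK hHN hLt hP hnt hodd
  -- a globally minimal model `Wd` of the twist
  have hD0 : (NumberField.discr K : ℚ) ≠ 0 := by exact_mod_cast NumberField.discr_ne_zero K
  haveI : (W.quadraticTwist (NumberField.discr K : ℚ)).IsElliptic := W.isElliptic_quadraticTwist hD0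
  obtain ⟨Cd, hCd⟩ := hasGlobalMinimalModel_rat_holds (W.quadraticTwist (NumberField.discr K : ℚ))
  haveI : (Cd • W.quadraticTwist (NumberField.discr K : ℚ)).IsGloballyMinimal := hCd
  set Wd := Cd • W.quadraticTwist (NumberField.discr K : ℚ) with hWd_def
  -- joint lower half over `(E, E^{(d_K)})` from the socket (item 19180 ✓)
  have hJ : JointLowerBoundAt W Wd 3 :=
    SchneiderFree.Exact.jointLowerBoundAt_of_stepL_manin hGZ hKo hGZK hmod hGZ73 W 3 (W.conductorNorm ℤ) K Dt H ι P
      Wd hr rfl h3N hK hodd hw3 hHN hLt hP ⟨Cd, rfl⟩ (by decide) hlo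
  -- the twist's upper half from Z; subtract
  have hUd : MissingUpperBoundAt Wd 3 :=
    (lower_and_upper_twist_of_wildRankZeroTwist hGZK hZ W hO6 hsurj rfl K hK hHN hodd Wd ⟨Cd, rfl⟩ hLt).2
  exact missingLowerBoundAt_of_joint_of_upper hJ hUd

/-! ### §2 The lower half on the cell ⟹ `L₃ʷ°` at every odd Friedberg–Hoffstein datum (PUB + Z) -/

/-- **`PublishedInputsWildThree → WildRankZeroTwistAtThree → [∀ cell W, MissingLowerBoundAt W 3] → L₃ʷ°`.** At an odd
Friedberg–Hoffstein datum `(W, K, Dt, H, ι, P)` of the cell: the lower half of `W` (hypothesis) and the lower half of a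
minimal model of the twist (Z, §0) give the joint lower half (`joint_of_lower_of_lower`), and soed-p2 g2's
`WildKolyvaginUpperAtThreeTight.indexLowerBoundLeAt_of_jointLowerBoundAt` (the converse Gross–Zagier bookkeeping) returns the
STEP-L socket at the Manin slack. CONDITIONAL; nothing asserted about any curve.
[cite: GrossZagier1986, Thm. I.(6.3) and (7.3)] [cite: JetchevSkinnerWan2017, §7.4.1 (arXiv:1512.06894 p. 30)]
[cite: Miller2011LMS, Def. 1.1 (arXiv:1010.2431 p. 3)] -/
theorem stepL_of_lowerHalf (hF : PublishedInputsWildThree) (hZ : WildRankZeroTwistAtThree)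
    (hLow : ∀ (W : WeierstrassCurve ℚ) [W.IsElliptic] [W.IsGloballyMinimal], ClassO6 W 3 →
      W.HasSurjectiveModNGaloisRep 3 → W.analyticRank = 1 → MissingLowerBoundAt W 3) :
    ∀ (W : WeierstrassCurve ℚ) [W.IsElliptic] [W.IsGloballyMinimal] (N : ℕ) [NeZero N] (K : Type) [Field K]
      [NumberField K] (Dt : ModularParametrizationData W N) (H : HeegnerDatum N (NumberField.discr K)) (ι : K →+* ℂ)
      (P : (W.baseChange K).toAffine.Point), ClassO6 W 3 → W.HasSurjectiveModNGaloisRep 3 → W.analyticRank = 1 →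
      W.conductorNorm ℤ = N → IsImaginaryQuadratic K → SatisfiesHeegnerHypothesis N K →
      (W.quadraticTwist (NumberField.discr K : ℚ)).entireLFunction 1 ≠ 0 →
      WeierstrassCurve.Affine.Point.map ι.toRatAlgHom P = heegnerPointComplex Dt H → ¬ IsOfFinAddOrder P →
      Odd (NumberField.discr K) → SchneiderFree.IndexLowerBoundLeAt W 3 K P (padicValNat 3 Dt.c.natAbs) := by
  intro W _ _ N _ K _ _ Dt H ι P hO6 hsurj hr hN hK hHH hLt hP _hnt hodd
  obtain ⟨hGZ, hKo, hGZK, hmod, -, -, hGZ73, -, -, -⟩ := hF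
  haveI : Fact (Nat.Prime 3) := ⟨Nat.prime_three⟩
  -- the lower half of `E` (hypothesis)
  have hlowW : MissingLowerBoundAt W 3 := hLow W hO6 hsurj hr
  -- a globally minimal model of the twist and its lower half (Z)
  have hD0 : (NumberField.discr K : ℚ) ≠ 0 := by exact_mod_cast NumberField.discr_ne_zero K
  haveI : (W.quadraticTwist (NumberField.discr K : ℚ)).IsElliptic := W.isElliptic_quadraticTwist hD0
  obtain ⟨Cd, hCd⟩ := hasGlobalMinimalModel_rat_holds (W.quadraticTwist (NumberField.discr K : ℚ))
  haveI : (Cd • W.quadraticTwist (NumberField.discr K : ℚ)).IsGloballyMinimal := hCd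
  set Wd := Cd • W.quadraticTwist (NumberField.discr K : ℚ) with hWd_def
  have hlowWd : MissingLowerBoundAt Wd 3 :=
    (lower_and_upper_twist_of_wildRankZeroTwist hGZK hZ W hO6 hsurj hN K hK hHH hodd Wd ⟨Cd, rfl⟩ hLt).1
  have hJ : JointLowerBoundAt W Wd 3 := joint_of_lower_of_lower hlowW hlowWd
  -- `3 ∣ N` splits in `K`: `3 ∤ #𝓞_K^×`; then the converse bookkeeping
  have h3N : 3 ∣ W.conductorNorm ℤ :=
    (W.dvd_conductorNorm_iff_not_hasGoodReductionAtPrime 3).mpr (not_good_of_addv W 3 hO6.2.1)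
  have hpN : 3 ∣ N := hN ▸ h3N
  have hw3 : ¬ 3 ∣ Units.torsionOrder K :=
    (X11b.Three.not_dvd_discr_and_not_dvd_torsionOrder_of_heegner hK hHH (by decide) hpN).2
  exact WildKolyvaginUpperAtThreeTight.indexLowerBoundLeAt_of_jointLowerBoundAt hGZ hKo hGZK hmod hGZ73 W 3 N K Dt H ι
    P Wd hr hN hpN hK hodd hw3 hHH hLt hP ⟨Cd, rfl⟩ (by decide) hJ

/-! ### §3 Modulo {PUB, Z}: `L₃ʷ°` ⟺ the lower half on the cell -/

/-- **Modulo {PublishedInputsWildThree, WildRankZeroTwistAtThree}: `L₃ʷ° ⟺ [∀ cell W, MissingLowerBoundAt W 3]`.** The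
Heegner-index socket of the route's kernels, read class-wide on the odd Friedberg–Hoffstein data, is the `r = 1` lower
half of `BSD₃` on the onto wild cell, curve by curve. CONDITIONAL bookkeeping (§1, §2).
[cite: Miller2011LMS, Def. 1.1 (arXiv:1010.2431 p. 3)] [cite: GrossZagier1986, Thm. I.(6.3) and (7.3)] -/
theorem stepL_iff_lowerHalf (hF : PublishedInputsWildThree) (hZ : WildRankZeroTwistAtThree) :
    (∀ (W : WeierstrassCurve ℚ) [W.IsElliptic] [W.IsGloballyMinimal] (N : ℕ) [NeZero N] (K : Type) [Field K]
      [NumberField K] (Dt : ModularParametrizationData W N) (H : HeegnerDatum N (NumberField.discr K)) (ι : K →+* ℂ)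
      (P : (W.baseChange K).toAffine.Point), ClassO6 W 3 → W.HasSurjectiveModNGaloisRep 3 → W.analyticRank = 1 →
      W.conductorNorm ℤ = N → IsImaginaryQuadratic K → SatisfiesHeegnerHypothesis N K →
      (W.quadraticTwist (NumberField.discr K : ℚ)).entireLFunction 1 ≠ 0 →
      WeierstrassCurve.Affine.Point.map ι.toRatAlgHom P = heegnerPointComplex Dt H → ¬ IsOfFinAddOrder P →
      Odd (NumberField.discr K) → SchneiderFree.IndexLowerBoundLeAt W 3 K P (padicValNat 3 Dt.c.natAbs)) ↔
    ∀ (W : WeierstrassCurve ℚ) [W.IsElliptic] [W.IsGloballyMinimal], ClassO6 W 3 → W.HasSurjectiveModNGaloisRep 3 →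
      W.analyticRank = 1 → MissingLowerBoundAt W 3 :=
  ⟨fun hL ↦ missingLowerBoundAt_of_stepL hF hZ hL, fun hLow ↦ stepL_of_lowerHalf hF hZ hLow⟩

/-! ### §4 Modulo {PUB, W, PT1, PT2, Z}: `E_𝟙^V` (BY NAME) ⟺ the lower half on the cell -/

/-- **The ℚ-level normal form of crux #2″.** Granted the print packages PUB (20389), W (24476: Hsieh Thm A ∧ BDP Thm 5.5 ∧
LZZ), PT1 (20461), PT2 (`poitouTate_sha_tateDual`, UTD item 20462) and the rank-zero leaf Z (20387):
`WildSplitEisensteinValueAtOneV ⟺ [∀ W, ClassO6 W 3 → ρ̄_{W,3} onto → r_an(W) = 1 → MissingLowerBoundAt W 3]`.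
⇒: `E_𝟙^V` → `L₃ʷ°` (p615634 §1: Kolyvagin, W, PT1) → lower half (§1). ⇐: lower half → `L₃ʷ°` (§2) → `E_𝟙^V` (p615634 §2
with its control hypothesis C discharged by utd-p3's `wildSplitControlAtThree_of_poitouTate` from PT1 + PT2). So the crux of
record is the `r = 1` «IMC / Eisenstein» half of `BSD₃` on the onto wild cell — no more, no less — and every line for it
is a line for that half. CONDITIONAL bookkeeping; nothing asserted about any curve.
[cite: JetchevSkinnerWan2017, Thm. 3.3.1 and §7.4.1 (arXiv:1512.06894 pp. 11, 30)] [cite: MilneADT2006, Ch. I, Thm. 4.10]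
[cite: Miller2011LMS, Def. 1.1 (arXiv:1010.2431 p. 3)] -/
theorem valueAtOneV_iff_lowerHalf (hF : PublishedInputsWildThree) (hW : WildSplitPrintedInputsAtThree)
    (hPT : PoitouTateSelmerStructureDualityFact) (hPT2 : Theses.UniversalToricDescent.PoitouTateShaTateDualFact)
    (hZ : WildRankZeroTwistAtThree) :
    WildSplitEisensteinValueAtOneV ↔
      ∀ (W : WeierstrassCurve ℚ) [W.IsElliptic] [W.IsGloballyMinimal], ClassO6 W 3 → W.HasSurjectiveModNGaloisRep 3 →
        W.analyticRank = 1 → MissingLowerBoundAt W 3 := by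
  have hKo : ∀ (N : ℕ) [NeZero N] (W : WeierstrassCurve ℚ) (K : Type) [Field K] [NumberField K],
      Literature.NumberTheory.EllipticCurves.kolyvagin N W K := hF.2.1
  have hC : WildSplitControlAtThree := fun W ↦
    UniversalToricDescentControl.wildSplitControlAtThree_of_poitouTate hPT (fun K _ _ ↦ hPT2 K) W
  refine ⟨fun hE1V ↦ missingLowerBoundAt_of_stepL hF hZ
      (WildSplitEisensteinValueAtOneVStepLNormalForm.stepL_of_valueAtOneV hE1V hKo hW hPT), fun hLow ↦ ?_⟩
  exact WildSplitEisensteinValueAtOneVStepLNormalForm.valueAtOneV_of_stepL_of_control (stepL_of_lowerHalf hF hZ hLow)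
    hKo hC

/-! ### §5 Modulo GZK: the rung ⟺ lower half ∧ upper half on the cell -/

/-- **`WAllExclAddWildRankOneSurj ⟺ [∀ cell W, MissingLowerBoundAt W 3] ∧ [∀ cell W, MissingUpperBoundAt W 3]`, granted
Gross–Zagier–Kolyvagin (`rank = r_an`, `Ш` finite in analytic rank `≤ 1`).** Miller's `BSD(E,3)` on the cell split into its
two halves (`lower_and_upper_of_missingPPartAt` / `missingPPartAt_of_lower_of_upper`, `bsdp_of_missingPPartAt`,
`missingPPartAt_of_bsdp`); the cell's `¬ HasCM` binder is automatic from `ρ̄₃` onto. Bookkeeping; nothing asserted about any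
curve. [cite: Miller2011LMS, §1 and Def. 1.1 (arXiv:1010.2431 p. 3)] [cite: Zywina2015, Prop. 1.14 and Prop. 1.16] -/
theorem wAllExclAddWildRankOneSurj_iff_lowerHalf_and_upperHalf (hGZK : rank_eq_analyticRank_of_analyticRank_le_one) :
    Summit.BirchSwinnertonDyer.WAllExclAddWildRankOneSurj ↔
      (∀ (W : WeierstrassCurve ℚ) [W.IsElliptic] [W.IsGloballyMinimal], ClassO6 W 3 → W.HasSurjectiveModNGaloisRep 3 →
        W.analyticRank = 1 → MissingLowerBoundAt W 3) ∧
      (∀ (W : WeierstrassCurve ℚ) [W.IsElliptic] [W.IsGloballyMinimal], ClassO6 W 3 → W.HasSurjectiveModNGaloisRep 3 →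
        W.analyticRank = 1 → MissingUpperBoundAt W 3) := by
  haveI : Fact (Nat.Prime 3) := ⟨Nat.prime_three⟩
  constructor
  · intro hleaf
    have hboth : ∀ (W : WeierstrassCurve ℚ) [W.IsElliptic] [W.IsGloballyMinimal], ClassO6 W 3 →
        W.HasSurjectiveModNGaloisRep 3 → W.analyticRank = 1 → MissingLowerBoundAt W 3 ∧ MissingUpperBoundAt W 3 := by
      intro W _ _ hO6 hsurj hr
      have hCM : ¬ W.HasCM := fun hCM ↦
        W.not_hasSurjectiveModNGaloisRep_of_hasCM hCM Nat.prime_three (by decide) hsurj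
      have hB : BSDp W 3 := hleaf W hCM hO6 hsurj hr
      obtain ⟨-, hfin⟩ := hGZK W (by rw [hr])
      haveI : Finite W.sha := hfin
      exact lower_and_upper_of_missingPPartAt W 3 (missingPPartAt_of_bsdp W 3 hB)
    exact ⟨fun W _ _ hO6 hsurj hr ↦ (hboth W hO6 hsurj hr).1, fun W _ _ hO6 hsurj hr ↦ (hboth W hO6 hsurj hr).2⟩
  · rintro ⟨hLow, hUp⟩
    unfold Summit.BirchSwinnertonDyer.WAllExclAddWildRankOneSurj
    intro W _ _ _hncm hO6 hsurj hr
    exact bsdp_of_missingPPartAt W 3 hGZK (by rw [hr])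
      (missingPPartAt_of_lower_of_upper W 3 (hLow W hO6 hsurj hr) (hUp W hO6 hsurj hr))

/-! ### §6 Modulo {PUB, W, PT1, PT2, Z}: the rung ⟺ `E_𝟙^V` ∧ the upper half on the cell -/

/-- **`WAllExclAddWildRankOneSurj ⟺ WildSplitEisensteinValueAtOneV ∧ [∀ cell W, MissingUpperBoundAt W 3]`, granted
{PUB, W, PT1, PT2, Z}.** The route's `closes`, at the level of statements: crux #2″ is exactly the lower half (§4) and the
Kolyvagin column (primitives 25896 + Jetchev max-form 25897 + `J‴` 25898 ⟹ Ko′) is consumed exactly as a supplier of the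
upper half; Z translates between `ℚ` and `K`. CONDITIONAL bookkeeping; BSD₃ is proved for no curve.
[cite: JetchevSkinnerWan2017, §7.4.1 (arXiv:1512.06894 p. 30)] [cite: Miller2011LMS, Def. 1.1 (arXiv:1010.2431 p. 3)] -/
theorem wAllExclAddWildRankOneSurj_iff_valueAtOneV_and_upperHalf (hF : PublishedInputsWildThree)
    (hW : WildSplitPrintedInputsAtThree) (hPT : PoitouTateSelmerStructureDualityFact)
    (hPT2 : Theses.UniversalToricDescent.PoitouTateShaTateDualFact) (hZ : WildRankZeroTwistAtThree) :
    Summit.BirchSwinnertonDyer.WAllExclAddWildRankOneSurj ↔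
      WildSplitEisensteinValueAtOneV ∧
      (∀ (W : WeierstrassCurve ℚ) [W.IsElliptic] [W.IsGloballyMinimal], ClassO6 W 3 → W.HasSurjectiveModNGaloisRep 3 →
        W.analyticRank = 1 → MissingUpperBoundAt W 3) := by
  rw [wAllExclAddWildRankOneSurj_iff_lowerHalf_and_upperHalf hF.2.2.1, valueAtOneV_iff_lowerHalf hF hW hPT hPT2 hZ]

end Summit.BirchSwinnertonDyer.BirchSwinnertonDyer.Theorems.WildSplitEisensteinValueAtOneVLowerHalf

end
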